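import Summits.BirchSwinnertonDyer.BirchSwinnertonDyer.Theorems.EisensteinPrimesFullDescentTateAlgebraPrime
import Summits.BirchSwinnertonDyer.BirchSwinnertonDyer.Theorems.EisensteinPrimesFullDescentTateBasis
import Summits.BirchSwinnertonDyer.BirchSwinnertonDyer.Theorems.EisensteinPrimesLinePsiAtMultiplicativePrime
import Literature.NumberTheory.EllipticCurves.OpenImageMazurProofs
import Literature.NumberTheory.EllipticCurves.PointDivisibilityProofs
import Literature.NumberTheory.GaloisCohomology.CyclotomicCharacterPPrimary
import Literature.NumberTheory.GaloisRepresentations.DecompositionGroupOfCompletion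
import HarnessLib

/-!
# Route `EisensteinPrimes`, crux 2 `GoodLatticeBDPValue` (stmt-BirchSwinnertonDyer-19032), line `halves`, road «R5 / AN-5»
# — brick TA-p-loc: the `ω`-line `C`, the module `p⁻¹C`, and steps A1/A2/A3 AT A SPLIT MULTIPLICATIVE `ℓ ≢ 1 (mod p)`,
# for an ARBITRARY prime `p`

Cell `bsd-eis` (home `run/shared/lean/pub/bsd-eis/`), width seat `bsd-line-x1-p1-w3` (gen 13; `--supports -19032`, closes
nothing by itself). The `p`-version, token for token, of §1–§2 of `FullDescentTheoremA` and §2 of `FullDescentTheoremAII`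
(LEAD g5, `p = 3`, `N = 9`), i.e. the LOCAL, curve-side consumers of the Tate-basis algebra `FullDescentTateAlgebraPrime`
(this seat) on width seat w7 (gen 7)'s road «R5 / AN-5» (T‴: a full-descent datum at `5 ≤ p` under the good-lattice
normalisation, HOME STATUS 2026-08-28T21:34:45Z; Case `ω`, steps A1–A3):

* §1 the `ω`-line `C = ⟨Q⟩ ≤ E[p]` (`σ Q = χ̄_p(σ) Q`, `Q ≠ 0`): `σ` acts on `C` as the scalar `χ̄_p(σ)`; `σ x − x ∈ C` for
  `x ∈ E[p]` (`det = χ̄_p`, Mazur); `σ x − χ̄_p(σ) x ∈ E[p]` for `px ∈ C`; `#p⁻¹C = p² · p`;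
* §2 (A1/A2 at a bad place) `W/ℚ` SPLIT multiplicative at `v`, `ℓ_v ≠ p`, `ℓ_v ≢ 1 (mod p)`: for `τ` in the local inertia
  group and `px ∈ C`, `res τ • x − x ∈ C` — in the level-`p²` Tate basis `(P₁', P₂')`
  (`FullDescentTateBasis.exists_tateBasis_geomPoints_of_hasSplitMultiplicativeReductionAt`, Tate uniformisation DISCHARGED),
  `C = ⟨pP₁'⟩` by (T-f)ₚ (a Frobenius acts on `C` and on `P₁'` through `χ̄ = ℓ ≢ 1 (mod p)`) and inertia (`χ̄_{p²} = 1`)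
  moves `x` inside `⟨pP₁'⟩` by (T-d)ₚ;
* §3 (A3 at a bad place) for a `Γ_ℚ`-stable `B ≤ E[p²]` of order `p²` with `B ∩ E[p] = C`: `B = ⟨P₁'⟩ = Ψ(μ_{p²})` by
  (T-c)ₚ, so the whole decomposition group acts on `B` through `χ̄_{p²}`.

HONEST FRAMING: helper theorems only (0 definitions, 0 named facts, 0 sorry); no summit statement, no BSD / IMC /
Keller–Yin theorem, no stub of the registered skeleton and no case of T‴ is proved by this file. References: [Kriz2016] Thm. 34;
[SilvermanATAEC1994] V.3.1, Lemma V.5.2, Thm. V.5.3; [SilvermanAEC2009] III.6.4, VII.4.1; [Mazur1978] §5;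
[NeukirchANT1999] I §10 (10.3), II §9 (9.6).
-/

set_option autoImplicit false

-- the route's Theorems namespace repeats the summit name by design (D-0017 nested layout)
set_option linter.dupNamespace false

noncomputable section

open scoped Classical NumberField

namespace Summit.BirchSwinnertonDyer.BirchSwinnertonDyer.Theorems.FullDescentTheoremAPrime

open NumberField IsDedekindDomain Field WeierstrassCurve Rat.HeightOneSpectrum
  Literature.NumberTheory.EllipticCurves Literature.NumberTheory.GaloisRepresentations
  Summit.BirchSwinnertonDyer.BirchSwinnertonDyer.Theorems

variable (W : WeierstrassCurve ℚ) [W.IsElliptic] {p : ℕ} [hp : Fact p.Prime]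

/-! ## §1. The `ω`-line `C = ⟨Q⟩` in `E(ℚ̄)`: stability, `Γ_ℚ` trivial on `E[p]/C`, the module `p⁻¹C` -/

omit [W.IsElliptic] in
/-- On `C = ⟨Q⟩`, `σ` acts as the scalar `χ̄_p(σ)`: `σ (k Q) = χ̄_p(σ) (k Q)`. [folklore] -/
theorem smul_eq_chi_smul_of_mem_zmultiples {Q : geomTorsion W (p : ℤ)}
    (hQ : ∀ σ : absoluteGaloisGroup ℚ, σ • Q = ((modNCyclotomicCharacter ℚ p σ : (ZMod p)ˣ) : ZMod p).val • Q)
    (σ : absoluteGaloisGroup ℚ) {x : geomPoints W} (hx : x ∈ AddSubgroup.zmultiples (Q : geomPoints W)) :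
    σ • x = (((modNCyclotomicCharacter ℚ p σ : (ZMod p)ˣ) : ZMod p).val : ℤ) • x := by
  obtain ⟨k, rfl⟩ := AddSubgroup.mem_zmultiples_iff.mp hx
  have hQc : σ • (Q : geomPoints W) = ((modNCyclotomicCharacter ℚ p σ : (ZMod p)ˣ) : ZMod p).val • (Q : geomPoints W) := by
    rw [← AddSubgroup.torsionBy.coe_smul, hQ σ, AddSubgroupClass.coe_nsmul]
  rw [FullDescentTateAlgebra.smul_zsmul_comm, hQc, smul_comm, natCast_zsmul]

/-- For the `ω`-point `Q ≠ 0` and every `x ∈ E[p]`: `σ x − x ∈ ⟨Q⟩` (the shape `(χ̄_p *; 0 𝟙)`: `det = χ̄_p`).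
[cite: Mazur1978, §5 (p. 148) and §6 proof of Prop. 6.3 (p. 153)] -/
theorem smul_sub_mem_zmultiples_of_omega {Q : geomTorsion W (p : ℤ)} (hQ0 : Q ≠ 0)
    (hQ : ∀ σ : absoluteGaloisGroup ℚ, σ • Q = ((modNCyclotomicCharacter ℚ p σ : (ZMod p)ˣ) : ZMod p).val • Q)
    (σ : absoluteGaloisGroup ℚ) {x : geomPoints W} (hx : x ∈ geomTorsion W (p : ℤ)) :
    σ • x - x ∈ AddSubgroup.zmultiples (Q : geomPoints W) := by
  have h := Mazur1978.smul_sub_smul_mem_zmultiples_of_isogenyCharacter W p hQ0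
    (r := modNCyclotomicCharacter ℚ p) hQ σ ⟨x, hx⟩
  rw [show modPCyclotomicCharacterZMod ℚ p = modNCyclotomicCharacter ℚ p from rfl, Units.mul_inv, ZMod.val_one,
    one_smul] at h
  obtain ⟨k, hk⟩ := AddSubgroup.mem_zmultiples_iff.mp h
  refine AddSubgroup.mem_zmultiples_iff.mpr ⟨k, ?_⟩
  have hk' := congrArg (Subtype.val : geomTorsion W (p : ℤ) → geomPoints W) hk
  simp only [AddSubgroupClass.coe_sub, AddSubgroup.torsionBy.coe_smul] at hk'
  rw [hk']

omit [W.IsElliptic] in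
/-- For `x` with `px ∈ ⟨Q⟩`: `σ x − χ̄_p(σ) x ∈ E[p]` (`p⁻¹C/E[p] ≅ C` via `×p` carries `χ̄_p`). [folklore] -/
theorem smul_sub_chi_smul_mem_torsion {Q : geomTorsion W (p : ℤ)}
    (hQ : ∀ σ : absoluteGaloisGroup ℚ, σ • Q = ((modNCyclotomicCharacter ℚ p σ : (ZMod p)ˣ) : ZMod p).val • Q)
    (σ : absoluteGaloisGroup ℚ) {x : geomPoints W}
    (hx : (p : ℤ) • x ∈ AddSubgroup.zmultiples (Q : geomPoints W)) :
    σ • x - (((modNCyclotomicCharacter ℚ p σ : (ZMod p)ˣ) : ZMod p).val : ℤ) • x ∈ geomTorsion W (p : ℤ) := by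
  rw [mem_torsionBy_iff, smul_sub, smul_comm (p : ℤ) σ x, smul_smul, mul_comm, mul_smul,
    smul_eq_chi_smul_of_mem_zmultiples W hQ σ hx, sub_self]

/-- **`#p⁻¹C = p² · p`** for a line `C = ⟨Q⟩ ≤ E[p]`: `x ↦ px` maps `p⁻¹C` ONTO `C` (points of `E(ℚ̄)` are `p`-divisible,
`zsmul_geomPoints_surjective_holds`) with kernel `E[p]` of order `p²`. [cite: SilvermanAEC2009, Cor. III.6.4] -/
theorem natCard_comap_prime {Q : geomTorsion W (p : ℤ)} (hQ0 : Q ≠ 0) :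
    Nat.card ((AddSubgroup.zmultiples (Q : geomPoints W)).comap (zsmulAddGroupHom (p : ℤ))) = p ^ 2 * p := by
  have hp0 : (p : ℤ) ≠ 0 := by exact_mod_cast hp.out.ne_zero
  set C : AddSubgroup (geomPoints W) := AddSubgroup.zmultiples (Q : geomPoints W) with hC
  set M : AddSubgroup (geomPoints W) := C.comap (zsmulAddGroupHom (p : ℤ)) with hM
  -- the map `g = (p •) : M → E(ℚ̄)`
  set g : M →+ geomPoints W := (zsmulAddGroupHom (p : ℤ)).comp M.subtype with hg
  have hg_apply : ∀ x : M, g x = (p : ℤ) • (x : geomPoints W) := fun x ↦ rfl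
  -- its range is `C`
  have hrange : g.range = C := by
    apply le_antisymm
    · rintro _ ⟨x, rfl⟩
      rw [hg_apply]
      exact (AddSubgroup.mem_comap.mp x.2)
    · intro c hc
      obtain ⟨x, hx⟩ := W.zsmul_geomPoints_surjective_holds (n := (p : ℤ)) hp0 c
      have hxM : x ∈ M := by
        rw [hM, AddSubgroup.mem_comap, zsmulAddGroupHom_apply]
        simp only at hx
        rwa [hx]
      exact ⟨⟨x, hxM⟩, by rw [hg_apply]; exact hx⟩
  -- its kernel is `E[p]` (inside `M`)
  have hker : g.ker = (geomTorsion W (p : ℤ)).addSubgroupOf M := by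
    ext x
    rw [AddMonoidHom.mem_ker, hg_apply, AddSubgroup.mem_addSubgroupOf, mem_torsionBy_iff]
  have hEpM : geomTorsion W (p : ℤ) ≤ M := by
    intro x hx
    rw [hM, AddSubgroup.mem_comap, zsmulAddGroupHom_apply]
    rw [mem_torsionBy_iff] at hx
    rw [hx]
    exact C.zero_mem
  have hp2 : Nat.card (geomTorsion W (p : ℤ)) = p ^ 2 := Literature.NumberTheory.EllipticCurves.natCard_geomTorsion W p
  have hcardker : Nat.card g.ker = p ^ 2 := by
    rw [hker, ← hp2]
    exact Nat.card_congr (AddSubgroup.addSubgroupOfEquivOfLe hEpM).toEquiv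
  have hcardrange : Nat.card g.range = p := by
    rw [hrange, hC, Nat.card_zmultiples, AddSubgroup.addOrderOf_coe, addOrderOf_eq_of_ne_zero W p hQ0]
  rw [AddSubgroup.card_eq_card_quotient_mul_card_addSubgroup g.ker, hcardker,
    Nat.card_congr (QuotientAddGroup.quotientKerEquivRange g).toEquiv, hcardrange]
  exact Nat.mul_comm _ _

/-! ## §2. A1/A2 at a split multiplicative `ℓ ≢ 1 (mod p)`: inertia is trivial on `p⁻¹C / C` -/

omit hp in
/-- Arithmetic of the Frobenius scalar: if `ℓ ≢ 1 (mod p)` then `p ∤ (ℓ mod p²) − 1`. [folklore] -/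
theorem not_dvd_mod_sq_sub_one {ℓ : ℕ} (hmod : ¬ ℓ ≡ 1 [MOD p]) : ¬ (p : ℤ) ∣ ((ℓ % p ^ 2 : ℕ) : ℤ) - 1 := by
  intro h
  apply hmod
  have h1 : ((ℓ % p ^ 2 : ℕ) : ℤ) ≡ ((1 : ℕ) : ℤ) [ZMOD (p : ℕ)] :=
    (Int.ModEq.symm ((Int.modEq_iff_dvd).mpr (by simpa using h)))
  have h2 : ℓ % p ^ 2 ≡ 1 [MOD p] := Int.natCast_modEq_iff.mp h1
  exact ((Nat.mod_modEq ℓ (p ^ 2)).of_dvd (dvd_pow_self p two_ne_zero)).symm.trans h2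

omit hp in
/-- Arithmetic of the Frobenius scalar on the `p`-torsion: `(ℓ mod p²) • y = (ℓ mod p) • y` when `py = 0`. [folklore] -/
theorem mod_sq_zsmul_eq_mod_zsmul {M : Type*} [AddCommGroup M] (ℓ : ℕ) {y : M} (hy : (p : ℤ) • y = 0) :
    ((ℓ % p ^ 2 : ℕ) : ℤ) • y = ((ℓ % p : ℕ) : ℤ) • y := by
  have hmod : ℓ % p ^ 2 ≡ ℓ % p [MOD p] :=
    ((Nat.mod_modEq ℓ (p ^ 2)).of_dvd (dvd_pow_self p two_ne_zero)).trans (Nat.mod_modEq ℓ p).symm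
  have hZ : ((ℓ % p ^ 2 : ℕ) : ℤ) ≡ ((ℓ % p : ℕ) : ℤ) [ZMOD (p : ℕ)] := Int.natCast_modEq_iff.mpr hmod
  obtain ⟨t, ht⟩ := (Int.modEq_iff_dvd.mp hZ.symm)
  have e : ((ℓ % p ^ 2 : ℕ) : ℤ) = ((ℓ % p : ℕ) : ℤ) + (p : ℤ) * t := by linarith
  rw [e, add_smul, mul_comm, mul_smul, hy, smul_zero, add_zero]

/-- **A1–A2 at a bad place.** `W/ℚ` split multiplicative at `v` with `ℓ_v ≠ p`, `ℓ_v ≢ 1 (mod p)`, `Q ≠ 0` an `ω`-point of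
`E[p]` (`σ Q = χ̄_p(σ) Q`): for every `τ` in the local inertia group and every `x` with `px ∈ ⟨Q⟩`, `res τ • x − x ∈ ⟨Q⟩`.
In the level-`p²` Tate basis `(P₁', P₂')`: `⟨Q⟩ = ⟨pP₁'⟩` ((T-f)ₚ: a Frobenius acts on `⟨Q⟩` and on `P₁'` through
`χ̄ = ℓ ≢ 1 (mod p)`), and inertia (`χ̄_{p²} = 1`) moves `x` inside `⟨pP₁'⟩` ((T-d)ₚ).
[cite: SilvermanATAEC1994, Thm. V.3.1 (c),(d), Lemma V.5.2, Thm. V.5.3] [cite: NeukirchANT1999, Ch. I §10 (10.3), Ch. II §9 Prop. (9.6)] -/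
theorem smul_sub_mem_of_mem_absInertia_of_split_sq {v : HeightOneSpectrum (𝓞 ℚ)} (hvp : natGenerator v ≠ p)
    (hsplit : W.HasSplitMultiplicativeReductionAt v) (hmod : ¬ natGenerator v ≡ 1 [MOD p])
    {Q : geomTorsion W (p : ℤ)} (hQ0 : Q ≠ 0)
    (hQ : ∀ σ : absoluteGaloisGroup ℚ, σ • Q = ((modNCyclotomicCharacter ℚ p σ : (ZMod p)ˣ) : ZMod p).val • Q)
    {τ : absoluteGaloisGroup (v.adicCompletion ℚ)} (hτ : τ ∈ absInertia (v.adicCompletion ℚ))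
    {x : geomPoints W} (hx : (p : ℤ) • x ∈ AddSubgroup.zmultiples (Q : geomPoints W)) :
    absGaloisRestrict ℚ (v.adicCompletion ℚ) τ • x - x ∈ AddSubgroup.zmultiples (Q : geomPoints W) := by
  have hpp : p.Prime := hp.out
  haveI hℓ : Fact (primesEquiv v : ℕ).Prime := ⟨(primesEquiv v).2⟩
  have hv : ((primesEquiv v : Nat.Primes) : ℕ) = natGenerator v := rfl
  -- the level-`p²` Tate basis
  obtain ⟨P₁, P₂, κ, -, -, hgen, hrel, hP₁, hP₂⟩ :=
    FullDescentTateBasis.exists_tateBasis_geomPoints_of_hasSplitMultiplicativeReductionAt W v hsplit (N := p ^ 2)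
  -- the composite action of `Γ_{ℚ_v}` on `E(ℚ̄)` through `res`
  letI inst : DistribMulAction (absoluteGaloisGroup (v.adicCompletion ℚ)) (geomPoints W) :=
    DistribMulAction.compHom _ (absGaloisRestrict ℚ (v.adicCompletion ℚ)).toMonoidHom
  have hdef : ∀ (σ : absoluteGaloisGroup (v.adicCompletion ℚ)) (y : geomPoints W),
      σ • y = absGaloisRestrict ℚ (v.adicCompletion ℚ) σ • y := fun _ _ ↦ rfl
  set χ : absoluteGaloisGroup (v.adicCompletion ℚ) → ℤ := fun σ ↦
    (((modNCyclotomicCharacter ℚ (p ^ 2) (absGaloisRestrict ℚ (v.adicCompletion ℚ) σ) : (ZMod (p ^ 2))ˣ) :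
      ZMod (p ^ 2)).val : ℤ) with hχ
  set κ' : absoluteGaloisGroup (v.adicCompletion ℚ) → ℤ := fun σ ↦ (κ σ : ℤ) with hκ'
  have hP₁' : ∀ σ : absoluteGaloisGroup (v.adicCompletion ℚ), σ • P₁ = χ σ • P₁ := fun σ ↦ by
    rw [hdef, hP₁ σ, hχ, natCast_zsmul]
  have hP₂' : ∀ σ : absoluteGaloisGroup (v.adicCompletion ℚ), σ • P₂ = P₂ + κ' σ • P₁ := fun σ ↦ by
    rw [hdef, hP₂ σ, hκ', natCast_zsmul]
  obtain ⟨hgenp, hrelp, hP₁p, hP₂p⟩ := FullDescentTateAlgebra.basis_prime_of_basis_sq hgen hrel hP₁' hP₂'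
  -- a Frobenius: `χ̄_{p²}(res σ₀) = ℓ`, `ℓ ≢ 1 (mod p)`
  obtain ⟨𝔐, h𝔐⟩ := v.localPrimesAbove_nonempty
  obtain ⟨σ₀, hσ₀⟩ := IsDedekindDomain.HeightOneSpectrum.exists_isArithFrobAt_localAbsIntegers v h𝔐
  have hℓp : ¬ natGenerator v ∣ p := fun h ↦
    hvp ((Nat.prime_dvd_prime_iff_eq (prime_natGenerator v) hpp).mp h)
  have hℓp2 : ¬ natGenerator v ∣ p ^ 2 := fun h ↦ hℓp ((prime_natGenerator v).dvd_of_dvd_pow h)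
  have hχσ₀ : χ σ₀ = ((natGenerator v % p ^ 2 : ℕ) : ℤ) := by
    have h := EisensteinPrimesLinePsiAtMultiplicativePrime.modNCyclotomicCharacter_absGaloisRestrict_frob
      (p := natGenerator v) hv h𝔐 hσ₀ (p ^ 2) hℓp2
    simp only [hχ]
    rw [h, ZMod.val_natCast]
  have hσ₀' : ¬ (p : ℤ) ∣ χ σ₀ - 1 := by
    rw [hχσ₀]
    exact not_dvd_mod_sq_sub_one hmod
  -- `χ̄_p(res σ₀) = ℓ` too, so `σ₀` acts on `⟨Q⟩` as the scalar `χ σ₀`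
  have hχpσ₀ : (((modNCyclotomicCharacter ℚ p (absGaloisRestrict ℚ (v.adicCompletion ℚ) σ₀) : (ZMod p)ˣ) :
      ZMod p).val : ℤ) = ((natGenerator v % p : ℕ) : ℤ) := by
    have h := EisensteinPrimesLinePsiAtMultiplicativePrime.modNCyclotomicCharacter_absGaloisRestrict_frob
      (p := natGenerator v) hv h𝔐 hσ₀ p hℓp
    rw [h, ZMod.val_natCast]
  have hQp : (p : ℤ) • (Q : geomPoints W) = 0 := mem_torsionBy_iff.mp Q.2
  have hact : ∀ y ∈ AddSubgroup.zmultiples (Q : geomPoints W), σ₀ • y = χ σ₀ • y := by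
    intro y hy
    rw [hdef, smul_eq_chi_smul_of_mem_zmultiples W hQ _ hy, hχpσ₀, hχσ₀]
    obtain ⟨k, rfl⟩ := AddSubgroup.mem_zmultiples_iff.mp hy
    have hpkQ : (p : ℤ) • (k • (Q : geomPoints W)) = 0 := by rw [smul_comm, hQp, smul_zero]
    exact (mod_sq_zsmul_eq_mod_zsmul (p := p) (natGenerator v) hpkQ).symm
  -- (T-f)ₚ: `⟨Q⟩ = ⟨p P₁⟩`
  have hCcard : Nat.card (AddSubgroup.zmultiples (Q : geomPoints W)) = p := by
    rw [Nat.card_zmultiples, AddSubgroup.addOrderOf_coe, addOrderOf_eq_of_ne_zero W p hQ0]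
  have hC : AddSubgroup.zmultiples (Q : geomPoints W) = AddSubgroup.zmultiples ((p : ℤ) • P₁) :=
    FullDescentTateAlgebra.eq_zmultiples_fst_of_smul_eq_chi_prime hgenp hrelp hP₁p hP₂p hσ₀' hCcard hact
  -- inertia: `χ̄_{p²}(res τ) = 1`
  have hp2v : ((p ^ 2 : ℕ) : 𝓞 ℚ) ∉ v.asIdeal := fun h ↦ hℓp2 ((Rat.natCast_mem_asIdeal_iff v).mp h)
  have hχτ : ((p ^ 2 : ℕ) : ℤ) ∣ χ τ - 1 := by
    have h := Literature.NumberTheory.GaloisCohomology.modNCyclotomicCharacter_absGaloisRestrict_eq_one_of_mem_absInertia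
      ℚ (p ^ 2) v hp2v hτ
    have hp21 : p ^ 2 ≠ 1 := (Nat.one_lt_pow two_ne_zero hpp.one_lt).ne'
    simp only [hχ]
    rw [h, Units.val_one, ZMod.val_one'' hp21, Nat.cast_one, sub_self]
    exact dvd_zero _
  have hx2 : ((p ^ 2 : ℕ) : ℤ) • x = 0 := by
    obtain ⟨k, hk⟩ := AddSubgroup.mem_zmultiples_iff.mp hx
    rw [FullDescentTateAlgebra.natCast_sq_eq_mul, mul_smul, ← hk, smul_comm, hQp, smul_zero]
  have key := FullDescentTateAlgebra.smul_sub_mem_zmultiples_of_sq hgen hrel hP₁' hP₂' hχτ hx2 (hC ▸ hx)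
  rw [hdef] at key
  rwa [hC]

/-! ## §3. A3 at a split multiplicative `ℓ ≢ 1 (mod p)`: the decomposition group acts on `B` through `χ̄_{p²}` -/

/-- **A3 at a bad place.** `W/ℚ` split multiplicative at `v` with `ℓ_v ≠ p`, `ℓ_v ≢ 1 (mod p)`, `Q ≠ 0` the `ω`-point,
`B ≤ E[p²]` of order `p²`, stable under `Γ_ℚ`, with `B ∩ E[p] = ⟨Q⟩`: every element of the decomposition group
`res(Γ_{ℚ_v})` acts on `B` through `χ̄_{p²}`. In the level-`p²` Tate basis: `⟨Q⟩ = ⟨pP₁'⟩` ((T-f)ₚ) and then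
`B = ⟨P₁'⟩ = Ψ(μ_{p²})` ((T-c)ₚ), on which `res τ` acts by `χ̄_{p²}(res τ)`.
[cite: SilvermanATAEC1994, Thm. V.3.1 (c),(d), Lemma V.5.2, Thm. V.5.3] [cite: NeukirchANT1999, Ch. I §10 (10.3), Ch. II §9 Prop. (9.6)] -/
theorem smul_eq_chi_sq_smul_of_split {v : HeightOneSpectrum (𝓞 ℚ)} (hvp : natGenerator v ≠ p)
    (hsplit : W.HasSplitMultiplicativeReductionAt v) (hmod : ¬ natGenerator v ≡ 1 [MOD p])
    {Q : geomTorsion W (p : ℤ)} (hQ0 : Q ≠ 0)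
    (hQ : ∀ σ : absoluteGaloisGroup ℚ, σ • Q = ((modNCyclotomicCharacter ℚ p σ : (ZMod p)ˣ) : ZMod p).val • Q)
    {B : AddSubgroup (geomPoints W)} (hB2 : B ≤ geomTorsion W ((p ^ 2 : ℕ) : ℤ)) (hcardB : Nat.card B = p ^ 2)
    (hBinf : B ⊓ geomTorsion W (p : ℤ) = AddSubgroup.zmultiples (Q : geomPoints W))
    (hBst : ∀ σ : absoluteGaloisGroup ℚ, ∀ x ∈ B, σ • x ∈ B)
    (τ : absoluteGaloisGroup (v.adicCompletion ℚ)) {x : geomPoints W} (hx : x ∈ B) :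
    absGaloisRestrict ℚ (v.adicCompletion ℚ) τ • x =
      ((modNCyclotomicCharacter ℚ (p ^ 2) (absGaloisRestrict ℚ (v.adicCompletion ℚ) τ) : (ZMod (p ^ 2))ˣ) :
        ZMod (p ^ 2)).val • x := by
  have hpp : p.Prime := hp.out
  haveI hℓ : Fact (primesEquiv v : ℕ).Prime := ⟨(primesEquiv v).2⟩
  have hv : ((primesEquiv v : Nat.Primes) : ℕ) = natGenerator v := rfl
  -- the level-`p²` Tate basis
  obtain ⟨P₁, P₂, κ, -, -, hgen, hrel, hP₁, hP₂⟩ :=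
    FullDescentTateBasis.exists_tateBasis_geomPoints_of_hasSplitMultiplicativeReductionAt W v hsplit (N := p ^ 2)
  letI inst : DistribMulAction (absoluteGaloisGroup (v.adicCompletion ℚ)) (geomPoints W) :=
    DistribMulAction.compHom _ (absGaloisRestrict ℚ (v.adicCompletion ℚ)).toMonoidHom
  have hdef : ∀ (σ : absoluteGaloisGroup (v.adicCompletion ℚ)) (y : geomPoints W),
      σ • y = absGaloisRestrict ℚ (v.adicCompletion ℚ) σ • y := fun _ _ ↦ rfl
  set χ : absoluteGaloisGroup (v.adicCompletion ℚ) → ℤ := fun σ ↦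
    (((modNCyclotomicCharacter ℚ (p ^ 2) (absGaloisRestrict ℚ (v.adicCompletion ℚ) σ) : (ZMod (p ^ 2))ˣ) :
      ZMod (p ^ 2)).val : ℤ) with hχ
  set κ' : absoluteGaloisGroup (v.adicCompletion ℚ) → ℤ := fun σ ↦ (κ σ : ℤ) with hκ'
  have hP₁' : ∀ σ : absoluteGaloisGroup (v.adicCompletion ℚ), σ • P₁ = χ σ • P₁ := fun σ ↦ by
    rw [hdef, hP₁ σ, hχ, natCast_zsmul]
  have hP₂' : ∀ σ : absoluteGaloisGroup (v.adicCompletion ℚ), σ • P₂ = P₂ + κ' σ • P₁ := fun σ ↦ by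
    rw [hdef, hP₂ σ, hκ', natCast_zsmul]
  obtain ⟨hgenp, hrelp, hP₁p, hP₂p⟩ := FullDescentTateAlgebra.basis_prime_of_basis_sq hgen hrel hP₁' hP₂'
  -- a Frobenius: `χ̄_{p²}(res σ₀) = ℓ`, `ℓ ≢ 1 (mod p)`
  obtain ⟨𝔐, h𝔐⟩ := v.localPrimesAbove_nonempty
  obtain ⟨σ₀, hσ₀⟩ := IsDedekindDomain.HeightOneSpectrum.exists_isArithFrobAt_localAbsIntegers v h𝔐
  have hℓp : ¬ natGenerator v ∣ p := fun h ↦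
    hvp ((Nat.prime_dvd_prime_iff_eq (prime_natGenerator v) hpp).mp h)
  have hℓp2 : ¬ natGenerator v ∣ p ^ 2 := fun h ↦ hℓp ((prime_natGenerator v).dvd_of_dvd_pow h)
  have hχσ₀ : χ σ₀ = ((natGenerator v % p ^ 2 : ℕ) : ℤ) := by
    have h := EisensteinPrimesLinePsiAtMultiplicativePrime.modNCyclotomicCharacter_absGaloisRestrict_frob
      (p := natGenerator v) hv h𝔐 hσ₀ (p ^ 2) hℓp2
    simp only [hχ]
    rw [h, ZMod.val_natCast]
  have hσ₀' : ¬ (p : ℤ) ∣ χ σ₀ - 1 := by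
    rw [hχσ₀]
    exact not_dvd_mod_sq_sub_one hmod
  have hχpσ₀ : (((modNCyclotomicCharacter ℚ p (absGaloisRestrict ℚ (v.adicCompletion ℚ) σ₀) : (ZMod p)ˣ) :
      ZMod p).val : ℤ) = ((natGenerator v % p : ℕ) : ℤ) := by
    have h := EisensteinPrimesLinePsiAtMultiplicativePrime.modNCyclotomicCharacter_absGaloisRestrict_frob
      (p := natGenerator v) hv h𝔐 hσ₀ p hℓp
    rw [h, ZMod.val_natCast]
  have hQp : (p : ℤ) • (Q : geomPoints W) = 0 := mem_torsionBy_iff.mp Q.2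
  have hact : ∀ y ∈ AddSubgroup.zmultiples (Q : geomPoints W), σ₀ • y = χ σ₀ • y := by
    intro y hy
    rw [hdef, smul_eq_chi_smul_of_mem_zmultiples W hQ _ hy, hχpσ₀, hχσ₀]
    obtain ⟨k, rfl⟩ := AddSubgroup.mem_zmultiples_iff.mp hy
    have hpkQ : (p : ℤ) • (k • (Q : geomPoints W)) = 0 := by rw [smul_comm, hQp, smul_zero]
    exact (mod_sq_zsmul_eq_mod_zsmul (p := p) (natGenerator v) hpkQ).symm
  -- (T-f)ₚ: `⟨Q⟩ = ⟨p P₁⟩`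
  have hCcard : Nat.card (AddSubgroup.zmultiples (Q : geomPoints W)) = p := by
    rw [Nat.card_zmultiples, AddSubgroup.addOrderOf_coe, addOrderOf_eq_of_ne_zero W p hQ0]
  have hC : AddSubgroup.zmultiples (Q : geomPoints W) = AddSubgroup.zmultiples ((p : ℤ) • P₁) :=
    FullDescentTateAlgebra.eq_zmultiples_fst_of_smul_eq_chi_prime hgenp hrelp hP₁p hP₂p hσ₀' hCcard hact
  -- (T-c)ₚ: `B = ⟨P₁⟩`
  have hB : B = AddSubgroup.zmultiples P₁ :=
    FullDescentTateAlgebra.eq_zmultiples_fst_of_stable_sq hgen hrel hP₁' hP₂' hσ₀' hcardB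
      (fun y hy ↦ mem_torsionBy_iff.mp (hB2 hy))
      (fun y hy ↦ by rw [hdef]; exact hBst _ y hy)
      (fun y hy hyp ↦ by
        rw [← hC, ← hBinf]
        exact AddSubgroup.mem_inf.mpr ⟨hy, mem_torsionBy_iff.mpr hyp⟩)
  -- conclusion on `x = k • P₁`
  rw [hB] at hx
  obtain ⟨k, rfl⟩ := AddSubgroup.mem_zmultiples_iff.mp hx
  rw [FullDescentTateAlgebra.smul_zsmul_comm, hP₁ τ, smul_comm]

end Summit.BirchSwinnertonDyer.BirchSwinnertonDyer.Theorems.FullDescentTheoremAPrime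

end
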